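import Summits.AtomisticToContinuum.HydrodynamicLimit.Theorems.JParityClosureParityRigidity
import HarnessLib

/-!
# Diagonal parity rigidity (stub S3c-b `stub_diagonalParityRigidity` of the line `preshock-kinetic-slaving`,
# crux `JParityClosure.EvenStressEnskog`, stmt-AtomisticToContinuum-13079) — the reduction to ONE estimate
# and the sequential fixed-law case

The registered stub `stub_diagonalParityRigidity` is the DIAGONAL form of the proved `ParityRigidity`
(`parityRigidity_proof`, Theorems/JParityClosureParityRigidity.lean): window laws `m_n → m` (weakly with
convergent quadratic-growth statistics), mollifier widths `ϑ_n → 0⁺`, and vanishing even entropy production of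
`(G_{ϑ_n} ∗ m_n ; m_n ⊗ m_n)` should force `m` to be a Dirac mass or a Maxwellian.  This file records what is
PROVED of it:

* `dirac_or_maxwellian_of_ae_map_collide_eq` — the endgame of the fixed-law proof is law-independent: a
  probability measure `m` with finite second moment whose pair law `m ⊗ m` is invariant under the elastic
  collision `collide ω` for a.e. impact direction `ω` is a Dirac mass or a Maxwellian (the landed
  `charFun_mul_eq_of_map_collide` / `charFun_mul_eq_of_ae` / `dirac_or_maxwellian_of_collision_invariant`);
* `stub_diagonalParityRigidity_of_ae_map_collide_eq` (registered sub-goal) — hence the diagonal stub follows,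
  verbatim, from ONE measure-theoretic statement, the DIAGONAL COLLISION INVARIANCE OF THE LIMIT PAIR LAW:
  under the hypotheses of the stub, `(m ⊗ m) ∘ (collide ω)⁻¹ = m ⊗ m` for `sphereMeasure`-a.e. `ω`.  This is the
  one missing estimate (see the module docstring of the companion plan: the fixed-law proof obtains it from the
  Gaussian relative differentiation `ae_tendsto_lintegral_exp_div` of a FIXED pair law, which has no analogue for
  moving laws; the exact-case mechanism that survives the diagonal is the energy identity
  `∫ (G ∗ ν) dν − ∫ (G ∗ T̂_# ν) dν = ½ ‖ν − T̂_# ν‖²_G` for the positive-definite Gaussian kernel);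
* `dirac_or_maxwellian_of_tendsto_seq` — the fixed-law rigidity along an ARBITRARY sequence `ϑ_n → 0⁺`
  (the tree's `ParityRigidity.dirac_or_maxwellian_of_tendsto` assumes the full one-sided limit `ϑ → 0⁺`; its
  proof, Tonelli + Fatou in the impact direction, Fatou in the velocity pair, Gaussian relative differentiation,
  is repeated here along the given sequence), and its corollary
* `diagonalParityRigidity_of_const` — the diagonal statement for CONSTANT sequences of laws `m_n = m`, i.e. the
  registered signature specialises correctly to the proved item `ParityRigidity` (sequential form).

References: C. Cercignani, R. Illner, M. Pulvirenti, *The Mathematical Theory of Dilute Gases* (1994) §3.1–3.2;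
C. Villani, *A review of mathematical topics in collisional kinetic theory* (2002) Ch. 1 §2.4, Ch. 2 §4.
-/

noncomputable section

open scoped BigOperators InnerProductSpace Topology ENNReal NNReal
open MeasureTheory Filter Set Metric Real
open Literature.MathematicalPhysics.KineticTheory Literature.Analysis.FluidPDE
open Summit.AtomisticToContinuum.HydrodynamicLimit.Theorems.ParityRigidity

namespace Summit.AtomisticToContinuum.HydrodynamicLimit.Theorems.EvenStressEnskog

section General

variable {E : Type*} [NormedAddCommGroup E] [InnerProductSpace ℝ E] [FiniteDimensional ℝ E]
  [MeasurableSpace E] [BorelSpace E]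

/-- **Endgame, law-independent.** A probability measure `m` with finite second moment on a real inner product
space of dimension `≥ 2` whose pair law `m ⊗ m` is invariant under `collide ω` for a.e. impact direction `ω` is a
Dirac mass or a Maxwellian law. [folklore] -/
theorem dirac_or_maxwellian_of_ae_map_collide_eq (hE : 2 ≤ Module.finrank ℝ E)
    (m : Measure E) [IsProbabilityMeasure m] (hm2 : Integrable (fun v => ‖v‖ ^ 2) m)
    (hinv : ∀ᵐ ω ∂(sphereMeasure : Measure (sphere (0 : E) 1)),
      (m.prod m).map (collide ω) = m.prod m) :
    (∃ u : E, m = Measure.dirac u) ∨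
      ∃ θ : ℝ, ∃ u : E, 0 < θ ∧
        m = (volume : Measure E).withDensity fun v => ENNReal.ofReal (localMaxwellian 1 θ u v) := by
  have h1 : MemLp id 1 m :=
    ((memLp_two_iff_integrable_sq_norm aestronglyMeasurable_id).2 hm2).mono_exponent one_le_two
  refine dirac_or_maxwellian_of_collision_invariant m hE h1 fun ω ξ η => ?_
  refine charFun_mul_eq_of_ae m ?_ ω ξ η
  filter_upwards [hinv] with ω hω
  exact fun ξ η => charFun_mul_eq_of_map_collide m ω hω ξ η

/-- **Fixed law, arbitrary sequence of widths.** If the even entropy production of the Gaussian mollifications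
`h_n = m ∗ G_{ϑ_n²}` of a probability measure `m` with finite second moment, integrated against `m ⊗ m`, tends
to `0` along SOME sequence of widths `ϑ_n > 0`, `ϑ_n → 0`, then `m` is a Dirac mass or a Maxwellian law
(dimension `≥ 2`).  Same proof as the tree's `ParityRigidity.dirac_or_maxwellian_of_tendsto`, run along the
given sequence instead of `1/(n+1)`. [folklore] -/
theorem dirac_or_maxwellian_of_tendsto_seq (hE : 2 ≤ Module.finrank ℝ E)
    (m : Measure E) [IsProbabilityMeasure m] (hm2 : Integrable (fun v => ‖v‖ ^ 2) m)
    (ϑs : ℕ → ℝ) (hϑpos : ∀ n, 0 < ϑs n) (hϑ0 : Tendsto ϑs atTop (𝓝 0))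
    (hlim : let h : ℕ → E → ℝ := fun n v => ∫ v', localMaxwellian 1 (ϑs n ^ 2) v v' ∂m
      let F : ℕ → sphere (0 : E) 1 → E × E → ℝ := fun n ω p =>
        Real.log (h n p.1) + Real.log (h n p.2) - Real.log (h n (collide ω p).1) -
          Real.log (h n (collide ω p).2)
      Tendsto (fun n => ∫⁻ p, ∫⁻ ω, ENNReal.ofReal (hardSphereKernel (p.2, p.1) ω *
        (F n ω p * (1 - Real.exp (-F n ω p)))) ∂sphereMeasure ∂(m.prod m)) atTop (𝓝 0)) :
    (∃ u : E, m = Measure.dirac u) ∨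
      ∃ θ : ℝ, ∃ u : E, 0 < θ ∧
        m = (volume : Measure E).withDensity fun v => ENNReal.ofReal (localMaxwellian 1 θ u v) := by
  set h : ℕ → E → ℝ := fun n v => ∫ v', localMaxwellian 1 (ϑs n ^ 2) v v' ∂m with hh_def
  set F : ℕ → sphere (0 : E) 1 → E × E → ℝ := fun n ω p =>
    Real.log (h n p.1) + Real.log (h n p.2) - Real.log (h n (collide ω p).1) -
      Real.log (h n (collide ω p).2) with hF_def
  replace hlim : Tendsto (fun n => ∫⁻ p, ∫⁻ ω, ENNReal.ofReal (hardSphereKernel (p.2, p.1) ω *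
      (F n ω p * (1 - Real.exp (-F n ω p)))) ∂sphereMeasure ∂(m.prod m)) atTop (𝓝 0) := hlim
  haveI : IsFiniteMeasure (sphereMeasure : Measure (sphere (0 : E) 1)) := by
    unfold sphereMeasure; infer_instance
  -- Step 1: reduce to the collision invariance of `m ⊗ m` for a.e. impact direction
  refine dirac_or_maxwellian_of_ae_map_collide_eq hE m hm2 ?_
  -- Step 2: the integrands `g_n`
  set g : ℕ → (E × E) × sphere (0 : E) 1 → ℝ≥0∞ := fun n q =>
    ENNReal.ofReal (hardSphereKernel (q.1.2, q.1.1) q.2 *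
      (F n q.2 q.1 * (1 - Real.exp (-F n q.2 q.1)))) with hg
  have hB : Measurable fun q : (E × E) × sphere (0 : E) 1 => hardSphereKernel (q.1.2, q.1.1) q.2 := by
    refine Continuous.measurable ?_
    show Continuous fun q : (E × E) × sphere (0 : E) 1 => max ⟪q.1.2 - q.1.1, (q.2 : E)⟫_ℝ 0
    fun_prop
  have hc1 : Continuous fun q : (E × E) × sphere (0 : E) 1 => (collide q.2 q.1).1 := by
    show Continuous fun q : (E × E) × sphere (0 : E) 1 =>
      q.1.1 - ⟪q.1.1 - q.1.2, (q.2 : E)⟫_ℝ • (q.2 : E)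
    fun_prop
  have hc2 : Continuous fun q : (E × E) × sphere (0 : E) 1 => (collide q.2 q.1).2 := by
    show Continuous fun q : (E × E) × sphere (0 : E) 1 =>
      q.1.2 + ⟪q.1.1 - q.1.2, (q.2 : E)⟫_ℝ • (q.2 : E)
    fun_prop
  have hg_meas : ∀ n, Measurable (g n) := by
    intro n
    have hhm : Measurable (h n) :=
      ParityRigidity.measurable_integral_localMaxwellian m (ϑs n)
    have hF : Measurable fun q : (E × E) × sphere (0 : E) 1 => F n q.2 q.1 :=
      (((hhm.comp measurable_fst.fst).log.add (hhm.comp measurable_fst.snd).log).sub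
        (hhm.comp hc1.measurable).log).sub (hhm.comp hc2.measurable).log
    exact (hB.mul (hF.mul (measurable_const.sub hF.neg.exp))).ennreal_ofReal
  -- Step 3: Tonelli and Fatou in the impact direction
  have hI : Tendsto (fun n => ∫⁻ p, ∫⁻ ω, g n (p, ω) ∂sphereMeasure ∂(m.prod m)) atTop (𝓝 0) :=
    hlim
  have hswap : ∀ n, ∫⁻ p, ∫⁻ ω, g n (p, ω) ∂sphereMeasure ∂(m.prod m) =
      ∫⁻ ω, ∫⁻ p, g n (p, ω) ∂(m.prod m) ∂sphereMeasure := fun n =>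
    lintegral_lintegral_swap (hg_meas n).aemeasurable
  have hG_meas : ∀ n, Measurable fun ω : sphere (0 : E) 1 => ∫⁻ p, g n (p, ω) ∂(m.prod m) :=
    fun n => (hg_meas n).lintegral_prod_left'
  have hI' : Tendsto (fun n => ∫⁻ ω, ∫⁻ p, g n (p, ω) ∂(m.prod m) ∂sphereMeasure) atTop (𝓝 0) := by
    simpa only [hswap] using hI
  have hFatou1 : ∫⁻ ω, liminf (fun n => ∫⁻ p, g n (p, ω) ∂(m.prod m)) atTop ∂sphereMeasure = 0 :=
    le_antisymm ((lintegral_liminf_le hG_meas).trans (le_of_eq hI'.liminf_eq)) bot_le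
  have hae1 : ∀ᵐ ω ∂(sphereMeasure : Measure (sphere (0 : E) 1)),
      liminf (fun n => ∫⁻ p, g n (p, ω) ∂(m.prod m)) atTop = 0 :=
    (lintegral_eq_zero_iff (Measurable.liminf hG_meas)).1 hFatou1
  filter_upwards [hae1] with ω hω
  replace hω : liminf (fun n => ∫⁻ p, g n (p, ω) ∂(m.prod m)) atTop = 0 := hω
  -- Step 4: Fatou in the velocity pair
  have hgp_meas : ∀ n, Measurable fun p : E × E => g n (p, ω) := fun n =>
    (hg_meas n).comp measurable_prodMk_right
  have hFatou2 : ∫⁻ p, liminf (fun n => g n (p, ω)) atTop ∂(m.prod m) = 0 :=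
    le_antisymm ((lintegral_liminf_le hgp_meas).trans (le_of_eq hω)) bot_le
  have hae2 : ∀ᵐ p ∂(m.prod m), liminf (fun n => g n (p, ω)) atTop = 0 :=
    (lintegral_eq_zero_iff (Measurable.liminf hgp_meas)).1 hFatou2
  -- Step 5: transport to the Euclidean product and apply the invariance criterion
  refine map_collide_prod_eq_of_ae_rnDeriv m ω ?_
  set ν : Measure (WithLp 2 (E × E)) := (m.prod m).map (WithLp.toLp 2) with hν
  set T : WithLp 2 (E × E) → WithLp 2 (E × E) :=
    fun x : WithLp 2 (E × E) => WithLp.toLp 2 (collide ω (WithLp.ofLp x)) with hT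
  have hTm : Measurable T :=
    (WithLp.measurable_toLp 2 _).comp
      ((ParityRigidity.continuous_collide ω).measurable.comp (WithLp.measurable_ofLp 2 _))
  haveI : IsFiniteMeasure (ν.map T) := Measure.isFiniteMeasure_map ν T
  have hGD := ae_tendsto_lintegral_exp_div ν (ν.map T)
  have hfin := Measure.rnDeriv_lt_top (ν.map T) ν
  have hemb : MeasurableEmbedding (WithLp.toLp 2 : E × E → WithLp 2 (E × E)) :=
    (MeasurableEquiv.toLp 2 (E × E)).measurableEmbedding
  have hae2' : ∀ᵐ x ∂ν, liminf (fun n => g n (WithLp.ofLp x, ω)) atTop = 0 := by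
    rw [hν, hemb.ae_map_iff]
    simpa only [WithLp.ofLp_toLp] using hae2
  filter_upwards [hGD, hfin, hae2'] with x hx hxfin hx0 hpos
  -- Step 6: the pointwise argument at a good point `x`
  have hBpos : 0 < hardSphereKernel ((WithLp.ofLp x).2, (WithLp.ofLp x).1) ω :=
    lt_max_of_lt_left hpos
  set r : ℕ → ℝ≥0∞ := fun n =>
    (∫⁻ z, ENNReal.ofReal (Real.exp (-‖x - z‖ ^ 2 / (2 * ϑs n ^ 2))) ∂(ν.map T)) /
      ∫⁻ z, ENNReal.ofReal (Real.exp (-‖x - z‖ ^ 2 / (2 * ϑs n ^ 2))) ∂ν with hr_def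
  have hs : Tendsto (fun n => 2 * ϑs n ^ 2) atTop (𝓝[>] 0) := by
    refine tendsto_nhdsWithin_iff.2 ⟨?_, Eventually.of_forall fun n => ?_⟩
    · simpa using (hϑ0.pow 2).const_mul 2
    · exact mul_pos two_pos (pow_pos (hϑpos n) 2)
  have hr : Tendsto r atTop (𝓝 ((ν.map T).rnDeriv ν x)) := hx.comp hs
  have hS : ∀ n, r n ≠ 0 ∧ r n ≠ ⊤ ∧ F n ω (WithLp.ofLp x) = -Real.log (r n).toReal := by
    intro n
    have h := ParityRigidity.surprisal_eq m (hϑpos n).ne' ω (WithLp.ofLp x) ν T hν hT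
    simp only [WithLp.toLp_ofLp] at h
    exact h
  have hfun : ∀ n, g n (WithLp.ofLp x, ω) =
      ENNReal.ofReal (hardSphereKernel ((WithLp.ofLp x).2, (WithLp.ofLp x).1) ω *
        (-Real.log (r n).toReal * (1 - Real.exp (-(-Real.log (r n).toReal))))) := by
    intro n
    simp only [hg]
    rw [(hS n).2.2]
  simp only [hfun] at hx0
  exact ParityRigidity.eq_one_of_liminf_eq_zero hxfin.ne hr (fun n => (hS n).1)
    (fun n => (hS n).2.1) hBpos hx0

end General

/-! ## The diagonal stub: reduction to the diagonal collision invariance of the limit pair law -/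

/-- **Reduction (registered sub-goal of `stub_diagonalParityRigidity`).**  The diagonal rigidity follows
VERBATIM from the diagonal collision invariance of the limit pair law: if, under the hypotheses of the stub
(window laws `m_n → m` with convergent quadratic-growth statistics, widths `ϑ_n → 0⁺`, vanishing even entropy
production of `(G_{ϑ_n} ∗ m_n ; m_n ⊗ m_n)`), the pair law `m ⊗ m` of the LIMIT is `collide ω`-invariant for
`sphereMeasure`-a.e. `ω`, then `m` is a Dirac mass or a Maxwellian.  The antecedent is the one missing estimate
of the line (I₃ of the plan); the consequent is the registered text of `stub_diagonalParityRigidity`. [folklore] -/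
theorem stub_diagonalParityRigidity_of_ae_map_collide_eq :
    (∀ (ms : ℕ → Measure V3) (m : Measure V3) (ϑs : ℕ → ℝ),
      (∀ n, IsProbabilityMeasure (ms n)) → IsProbabilityMeasure m →
      (∀ n, 0 < ϑs n) → Tendsto ϑs atTop (𝓝 0) →
      (∀ n, Integrable (fun v : V3 => ‖v‖ ^ 2) (ms n)) → Integrable (fun v : V3 => ‖v‖ ^ 2) m →
      (∀ G : V3 → ℝ, Continuous G → (∃ C : ℝ, ∀ v, |G v| ≤ C * (1 + ‖v‖ ^ 2)) →
        Tendsto (fun n => ∫ v, G v ∂(ms n)) atTop (𝓝 (∫ v, G v ∂m))) →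
      (let h : ℕ → V3 → ℝ := fun n v => ∫ v', localMaxwellian 1 (ϑs n ^ 2) v v' ∂(ms n);
       let F : ℕ → Metric.sphere (0 : V3) 1 → V3 × V3 → ℝ := fun n ω p =>
         Real.log (h n p.1) + Real.log (h n p.2) - Real.log (h n (collide ω p).1) -
           Real.log (h n (collide ω p).2);
       Tendsto (fun n => ∫⁻ p, ∫⁻ ω, ENNReal.ofReal (hardSphereKernel (p.2, p.1) ω *
          (F n ω p * (1 - Real.exp (-F n ω p)))) ∂sphereMeasure ∂((ms n).prod (ms n))) atTop (𝓝 0)) →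
      ∀ᵐ ω ∂(sphereMeasure : Measure (Metric.sphere (0 : V3) 1)),
        (m.prod m).map (collide ω) = m.prod m) →
  ∀ (ms : ℕ → Measure V3) (m : Measure V3) (ϑs : ℕ → ℝ),
    (∀ n, IsProbabilityMeasure (ms n)) → IsProbabilityMeasure m →
    (∀ n, 0 < ϑs n) → Tendsto ϑs atTop (𝓝 0) →
    (∀ n, Integrable (fun v : V3 => ‖v‖ ^ 2) (ms n)) → Integrable (fun v : V3 => ‖v‖ ^ 2) m →
    (∀ G : V3 → ℝ, Continuous G → (∃ C : ℝ, ∀ v, |G v| ≤ C * (1 + ‖v‖ ^ 2)) →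
      Tendsto (fun n => ∫ v, G v ∂(ms n)) atTop (𝓝 (∫ v, G v ∂m))) →
    (let h : ℕ → V3 → ℝ := fun n v => ∫ v', localMaxwellian 1 (ϑs n ^ 2) v v' ∂(ms n);
     let F : ℕ → Metric.sphere (0 : V3) 1 → V3 × V3 → ℝ := fun n ω p =>
       Real.log (h n p.1) + Real.log (h n p.2) - Real.log (h n (collide ω p).1) -
         Real.log (h n (collide ω p).2);
     Tendsto (fun n => ∫⁻ p, ∫⁻ ω, ENNReal.ofReal (hardSphereKernel (p.2, p.1) ω *
        (F n ω p * (1 - Real.exp (-F n ω p)))) ∂sphereMeasure ∂((ms n).prod (ms n))) atTop (𝓝 0)) →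
    (∃ u : V3, m = Measure.dirac u) ∨
      (∃ θ : ℝ, ∃ u : V3, 0 < θ ∧
        m = (volume : Measure V3).withDensity (fun v => ENNReal.ofReal (localMaxwellian 1 θ u v))) := by
  intro hML ms m ϑs hms hm hpos h0 hms2 hm2 hweak hprod
  have hE : 2 ≤ Module.finrank ℝ V3 := by
    rw [finrank_euclideanSpace_fin]
    norm_num
  exact dirac_or_maxwellian_of_ae_map_collide_eq hE m hm2
    (hML ms m ϑs hms hm hpos h0 hms2 hm2 hweak hprod)

/-- **The diagonal statement for constant sequences of laws.**  If all window laws coincide, `m_n = m`, the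
hypotheses of `stub_diagonalParityRigidity` (vanishing production along `ϑ_n → 0⁺`) already force `m` to be a
Dirac mass or a Maxwellian: the registered diagonal signature specialises to the (sequential form of the) proved
item `ParityRigidity`. [folklore] -/
theorem diagonalParityRigidity_of_const :
  ∀ (ms : ℕ → Measure V3) (m : Measure V3) (ϑs : ℕ → ℝ), (∀ n, ms n = m) →
    IsProbabilityMeasure m →
    (∀ n, 0 < ϑs n) → Tendsto ϑs atTop (𝓝 0) →
    Integrable (fun v : V3 => ‖v‖ ^ 2) m →
    (let h : ℕ → V3 → ℝ := fun n v => ∫ v', localMaxwellian 1 (ϑs n ^ 2) v v' ∂(ms n)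
     let F : ℕ → Metric.sphere (0 : V3) 1 → V3 × V3 → ℝ := fun n ω p =>
       Real.log (h n p.1) + Real.log (h n p.2) - Real.log (h n (collide ω p).1) -
         Real.log (h n (collide ω p).2)
     Tendsto (fun n => ∫⁻ p, ∫⁻ ω, ENNReal.ofReal (hardSphereKernel (p.2, p.1) ω *
        (F n ω p * (1 - Real.exp (-F n ω p)))) ∂sphereMeasure ∂((ms n).prod (ms n))) atTop (𝓝 0)) →
    (∃ u : V3, m = Measure.dirac u) ∨
      (∃ θ : ℝ, ∃ u : V3, 0 < θ ∧
        m = (volume : Measure V3).withDensity (fun v => ENNReal.ofReal (localMaxwellian 1 θ u v))) := by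
  intro ms m ϑs hconst hm hpos h0 hm2 hprod
  have hfun : ms = fun _ => m := funext hconst
  subst hfun
  have hE : 2 ≤ Module.finrank ℝ V3 := by
    rw [finrank_euclideanSpace_fin]
    norm_num
  exact dirac_or_maxwellian_of_tendsto_seq hE m hm2 ϑs hpos h0 hprod

end Summit.AtomisticToContinuum.HydrodynamicLimit.Theorems.EvenStressEnskog

end
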